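import Literature.Analysis.PDE.EllipticDifferentiatedProblem
import Literature.Analysis.Calculus.CoordinateJets
import HarnessLib

/-!
# Helper `helper_regularityInduction_of` of line `margerin-cone-hamilton-rails`
# (crux `EntropyRung.ChangGurskyYang`, item stmt-SmoothPoincare4-10834):
# the elliptic regularity induction `C^{2,α} ⇒ C^{m+3,α}` from its two steps

Registered helper stub Rind of the lead's skeleton of line `margerin-cone-hamilton-rails` (part of
the elliptic-regularity stub O3 `stub_regularity`): for a smooth structure function `H` on
`P × CJet ι 2`, a coefficient map `c ∈ C^{m+1,α}(B(x₀, R); P)` and a solution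
`v ∈ C^{2,α}(B(x₀, R))` of `H(c(y), cjet₂ v(y)) = 0` that is uniformly elliptic on a
neighbourhood of the graph `(c, cjet₂ v)`, the solution is `C^{m+3,α}` with bounds on every
smaller concentric ball (Gilbarg–Trudinger 2001, Lemma 17.16, regularity half).  This file proves
the induction on `m` FROM its two registered steps, taken as hypotheses (they are the neighbouring
stubs `helper_dqRegularityStep` = R3gen, the difference-quotient step `C^{2,α} ⇒ C^{3,α}` for
`c ∈ C^{1,α}`, and `helper_differentiateEquation` = Rdiff, differentiating the equation once along
a basis direction):

* `m = 0` is R3gen;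
* `m → m + 1`: by the induction hypothesis (with the same parameter space) `v ∈ C^{m+3,α}` on an
  intermediate ball `B(x₀, ρ₁)`; by Rdiff each `v_k = ∂_{e_k} v ∈ C^{2,α}(B(x₀, ρ₁))` solves the
  differentiated equation `H♯(c♯(y), cjet₂ v_k(y)) = 0` with the ENLARGED parameter space
  `P♯ = P × (CJet ι 2 × P)`, `H♯((p, J₀, p₁), J) = DH(p, J₀)·(p₁, J)` smooth,
  `c♯ = (c, cjet₂ v, ∂_{e_k} c) ∈ C^{m+1,α}` and the same ellipticity near the new graph
  (`Literature/Analysis/PDE/EllipticDifferentiatedProblem.lean`); the induction hypothesis — which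
  quantifies over the parameter space — applied to `(P♯, H♯, c♯, v_k)` gives
  `v_k ∈ C^{m+3,α}(B(x₀, ρ))`, and `D^{m+4}v` is reassembled from the `D^{m+3}v_k`
  (`Literature.Analysis.FunctionSpaces.holderData_succ_of_basis`).

References: D. Gilbarg, N. S. Trudinger, *Elliptic Partial Differential Equations of Second
Order* (2001), Lemma 17.16 [GilbargTrudinger2001].
-/

noncomputable section

-- every `Summit.SmoothPoincare4.SmoothPoincare4.…` name repeats the summit = sub-problem segment (D-0017 layout)
set_option linter.dupNamespace false

namespace Summit.SmoothPoincare4.SmoothPoincare4.Theorems.MargerinRails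

open Metric

/-- **Rind from R3gen and Rdiff: the elliptic regularity induction** (Gilbarg–Trudinger 2001,
Lemma 17.16, regularity half).  Assume (R3gen) the difference-quotient step — a `C^{2,α}`
solution `v` of `H(c(y), cjet₂ v(y)) = 0` on `B(x₀, R)` with `H` smooth, `c ∈ C^{1,α}` and
uniform ellipticity near the graph is `C^{3,α}` with bounds on every smaller concentric ball — and
(Rdiff) that such an equation with `c ∈ C¹`, `v ∈ C³` differentiates along each basis direction
`e_k` to `DH(c(y), cjet₂ v(y))·(Dc(y) e_k, cjet₂ (∂_{e_k} v)(y)) = 0`.  Then for every `m`, every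
finite-dimensional parameter space `P`, smooth `H : P × CJet ι 2 → ℝ`, `c ∈ C^{m+1,α}(B(x₀, R))`
with bounds and every `C^{2,α}` solution `v` with bounds, uniformly elliptic near the graph,
`v ∈ C^{m+3,α}(B(x₀, ρ))` with bounds for all `0 < ρ < R` (induction on `m` generalizing `P`:
the directional derivatives solve the differentiated equation, whose parameter space is
`P × (CJet ι 2 × P)`). [cite: GilbargTrudinger2001, Lemma 17.16] -/
theorem helper_regularityInduction_of :
    (∀ {ι : Type} [Fintype ι] [DecidableEq ι] {E : Type} [NormedAddCommGroup E] [InnerProductSpace ℝ E]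
      [FiniteDimensional ℝ E] [MeasurableSpace E] [BorelSpace E] [Nontrivial E]
      {P : Type} [NormedAddCommGroup P] [NormedSpace ℝ P] [FiniteDimensional ℝ P]
      (bE : OrthonormalBasis ι ℝ E) {α : NNReal}, 0 < α → α < 1 →
      ∀ (H : P × Literature.Analysis.Calculus.CJet ι 2 → ℝ),
      ContDiff ℝ ((⊤ : ℕ∞) : WithTop ℕ∞) H →
      ∀ (c : E → P) (v : E → ℝ) (x₀ : E) (R : ℝ), 0 < R →
      ContDiffOn ℝ 1 c (Metric.ball x₀ R) →
      (∃ Bc : NNReal, (∀ y ∈ Metric.ball x₀ R, ∀ j ≤ 1, ‖iteratedFDeriv ℝ j c y‖ ≤ Bc) ∧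
        HolderOnWith Bc α (iteratedFDeriv ℝ 1 c) (Metric.ball x₀ R)) →
      ContDiffOn ℝ 2 v (Metric.ball x₀ R) →
      (∃ Bv : NNReal, (∀ y ∈ Metric.ball x₀ R, ∀ j ≤ 2, ‖iteratedFDeriv ℝ j v y‖ ≤ Bv) ∧
        HolderOnWith Bv α (iteratedFDeriv ℝ 2 v) (Metric.ball x₀ R)) →
      (∀ y ∈ Metric.ball x₀ R, H (c y, Literature.Analysis.Calculus.cjetOf bE 2 v y) = 0) →
      (∃ l δ : ℝ, 0 < l ∧ 0 < δ ∧ ∀ y ∈ Metric.ball x₀ R,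
        ∀ (p' : P) (J' : Literature.Analysis.Calculus.CJet ι 2),
          ‖p' - c y‖ < δ → ‖J' - Literature.Analysis.Calculus.cjetOf bE 2 v y‖ < δ →
          ∀ η : E →L[ℝ] ℝ, l * ‖η‖ ^ 2 ≤
            fderiv ℝ H (p', J') ((0 : P), Pi.single (Fin.last 2)
              (fun I : Fin 2 → ι => η (bE (I 0)) * η (bE (I 1))))) →
      ∀ ρ : ℝ, 0 < ρ → ρ < R →
        ContDiffOn ℝ 3 v (Metric.ball x₀ ρ) ∧
        ∃ B' : NNReal, (∀ y ∈ Metric.ball x₀ ρ, ∀ j ≤ 3, ‖iteratedFDeriv ℝ j v y‖ ≤ B') ∧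
          HolderOnWith B' α (iteratedFDeriv ℝ 3 v) (Metric.ball x₀ ρ)) →
    (∀ {ι : Type} [Fintype ι] [DecidableEq ι] {E : Type} [NormedAddCommGroup E] [InnerProductSpace ℝ E]
      [FiniteDimensional ℝ E] {P : Type} [NormedAddCommGroup P] [NormedSpace ℝ P]
      (bE : OrthonormalBasis ι ℝ E) (H : P × Literature.Analysis.Calculus.CJet ι 2 → ℝ),
      ContDiff ℝ 1 H →
      ∀ (c : E → P) (v : E → ℝ) (U : Set E), IsOpen U → ContDiffOn ℝ 1 c U → ContDiffOn ℝ 3 v U →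
      (∀ y ∈ U, H (c y, Literature.Analysis.Calculus.cjetOf bE 2 v y) = 0) →
      ∀ (k : ι), ∀ y ∈ U,
        fderiv ℝ H (c y, Literature.Analysis.Calculus.cjetOf bE 2 v y)
          (fderiv ℝ c y (bE k),
            Literature.Analysis.Calculus.cjetOf bE 2 (fun z => fderiv ℝ v z (bE k)) y) = 0) →
    ∀ {ι : Type} [Fintype ι] [DecidableEq ι] {E : Type} [NormedAddCommGroup E] [InnerProductSpace ℝ E]
      [FiniteDimensional ℝ E] [MeasurableSpace E] [BorelSpace E] [Nontrivial E]
      (bE : OrthonormalBasis ι ℝ E) {α : NNReal}, 0 < α → α < 1 → ∀ (m : ℕ)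
      {P : Type} [NormedAddCommGroup P] [NormedSpace ℝ P] [FiniteDimensional ℝ P]
      (H : P × Literature.Analysis.Calculus.CJet ι 2 → ℝ),
      ContDiff ℝ ((⊤ : ℕ∞) : WithTop ℕ∞) H →
      ∀ (c : E → P) (v : E → ℝ) (x₀ : E) (R : ℝ), 0 < R →
      ContDiffOn ℝ (m + 1) c (Metric.ball x₀ R) →
      (∃ Bc : NNReal, (∀ y ∈ Metric.ball x₀ R, ∀ j ≤ m + 1, ‖iteratedFDeriv ℝ j c y‖ ≤ Bc) ∧
        HolderOnWith Bc α (iteratedFDeriv ℝ (m + 1) c) (Metric.ball x₀ R)) →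
      ContDiffOn ℝ 2 v (Metric.ball x₀ R) →
      (∃ Bv : NNReal, (∀ y ∈ Metric.ball x₀ R, ∀ j ≤ 2, ‖iteratedFDeriv ℝ j v y‖ ≤ Bv) ∧
        HolderOnWith Bv α (iteratedFDeriv ℝ 2 v) (Metric.ball x₀ R)) →
      (∀ y ∈ Metric.ball x₀ R, H (c y, Literature.Analysis.Calculus.cjetOf bE 2 v y) = 0) →
      (∃ l δ : ℝ, 0 < l ∧ 0 < δ ∧ ∀ y ∈ Metric.ball x₀ R,
        ∀ (p' : P) (J' : Literature.Analysis.Calculus.CJet ι 2),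
          ‖p' - c y‖ < δ → ‖J' - Literature.Analysis.Calculus.cjetOf bE 2 v y‖ < δ →
          ∀ η : E →L[ℝ] ℝ, l * ‖η‖ ^ 2 ≤
            fderiv ℝ H (p', J') ((0 : P), Pi.single (Fin.last 2)
              (fun I : Fin 2 → ι => η (bE (I 0)) * η (bE (I 1))))) →
      ∀ ρ : ℝ, 0 < ρ → ρ < R →
        ContDiffOn ℝ (m + 3) v (Metric.ball x₀ ρ) ∧
        ∃ B' : NNReal, (∀ y ∈ Metric.ball x₀ ρ, ∀ j ≤ m + 3, ‖iteratedFDeriv ℝ j v y‖ ≤ B') ∧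
          HolderOnWith B' α (iteratedFDeriv ℝ (m + 3) v) (Metric.ball x₀ ρ) := by
  intro hR3 hRd ι _ _ E _ _ _ _ _ _ bE α hα0 hα1 m
  induction m with
  | zero =>
      intro P _ _ _ H hH c v x₀ R hR hc hcB hv hvB heq hell ρ hρ hρR
      simp only [Nat.cast_zero, zero_add] at hc hcB ⊢
      exact hR3 bE hα0 hα1 H hH c v x₀ R hR hc hcB hv hvB heq hell ρ hρ hρR
  | succ m ih =>
      intro P _ _ _ H hH c v x₀ R hR hc hcB hv hvB heq hell ρ hρ hρR
      -- casts: `C^{(m+1)+1} = C^{m+2}`, `C^{(m+1)+3} = C^{(m+3)+1}`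
      have hc2 : ContDiffOn ℝ (m + 2 : ℕ) c (ball x₀ R) := by
        have h : ((m + 2 : ℕ) : WithTop ℕ∞) = (m + 1 : ℕ) + 1 := by push_cast; ring
        rw [h]
        exact hc
      have hcB2 : ∃ Bc : NNReal, (∀ y ∈ ball x₀ R, ∀ j ≤ m + 2, ‖iteratedFDeriv ℝ j c y‖ ≤ Bc) ∧
          HolderOnWith Bc α (iteratedFDeriv ℝ (m + 2) c) (ball x₀ R) := hcB
      -- the intermediate radius
      obtain ⟨ρ₁, hρρ₁, hρ₁R⟩ := exists_between hρR
      have hρ₁0 : 0 < ρ₁ := hρ.trans hρρ₁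
      have hsub₁ : ball x₀ ρ₁ ⊆ ball x₀ R := ball_subset_ball hρ₁R.le
      have hsubρ : ball x₀ ρ ⊆ ball x₀ ρ₁ := ball_subset_ball hρρ₁.le
      -- Step 1: the induction hypothesis for `(P, H, c, v)` on `B(x₀, ρ₁)`
      have hcLow := Literature.Analysis.FunctionSpaces.holderBallData_of_le (n := m + 1)
        (N := m + 2) (by omega) hα1.le hc2 hcB2
      have h1 := ih H hH c v x₀ R hR (by exact_mod_cast hcLow.1) hcLow.2 hv hvB heq hell ρ₁
        hρ₁0 hρ₁R
      have h1c : ContDiffOn ℝ (m + 3 : ℕ) v (ball x₀ ρ₁) := by exact_mod_cast h1.1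
      -- Steps 2–5: each directional derivative is `C^{m+3,α}` on `B(x₀, ρ)`
      have hk : ∀ k : ι, ContDiffOn ℝ (m + 3 : ℕ) (fun z => fderiv ℝ v z (bE k)) (ball x₀ ρ) ∧
          ∃ B : NNReal, (∀ y ∈ ball x₀ ρ, ∀ j ≤ m + 3,
            ‖iteratedFDeriv ℝ j (fun z => fderiv ℝ v z (bE k)) y‖ ≤ B) ∧
          HolderOnWith B α (iteratedFDeriv ℝ (m + 3) (fun z => fderiv ℝ v z (bE k)))
            (ball x₀ ρ) := by
        intro k
        -- the new unknown `v_k ∈ C^{2,α}(B(x₀, ρ₁))`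
        have h2 := Literature.Analysis.PDE.holderData_fderiv_apply_basis_two bE hα1.le h1c
          h1.2 k
        -- the differentiated equation on `B(x₀, ρ₁)`
        have h3 : ∀ y ∈ ball x₀ ρ₁,
            (fun q : (P × (Literature.Analysis.Calculus.CJet ι 2 × P)) ×
                Literature.Analysis.Calculus.CJet ι 2 =>
              fderiv ℝ H (q.1.1, q.1.2.1) (q.1.2.2, q.2))
              ((c y, Literature.Analysis.Calculus.cjetOf bE 2 v y, fderiv ℝ c y (bE k)),
                Literature.Analysis.Calculus.cjetOf bE 2 (fun z => fderiv ℝ v z (bE k)) y) = 0 :=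
          hRd bE H (hH.of_le (by exact_mod_cast (le_top : (1 : ℕ∞) ≤ ⊤))) c v (ball x₀ ρ₁)
            isOpen_ball
            ((hc2.mono hsub₁).of_le (by norm_cast; omega))
            (h1c.of_le (by norm_cast; omega)) (fun y hy => heq y (hsub₁ hy)) k
        -- the new coefficients `c♯ ∈ C^{m+1,α}(B(x₀, ρ₁))`
        have h4 := Literature.Analysis.PDE.holderData_linearisedCoeff bE hρ₁R.le hα1.le hc2 hcB2
          h1c h1.2 k
        -- ellipticity near the new graph
        obtain ⟨l, δ, hl, hδ, hell'⟩ := hell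
        have h5 := Literature.Analysis.PDE.linearisedStructure_elliptic_near bE hH
          (fun y hy => hell' y (hsub₁ hy)) (fun y => fderiv ℝ c y (bE k))
          (Literature.Analysis.Calculus.cjetOf bE 2 (fun z => fderiv ℝ v z (bE k)))
        -- the induction hypothesis for the differentiated problem
        have h6 := ih (P := P × (Literature.Analysis.Calculus.CJet ι 2 × P))
          (fun q => fderiv ℝ H (q.1.1, q.1.2.1) (q.1.2.2, q.2))
          (Literature.Analysis.PDE.contDiff_linearisedStructure hH)
          (fun y => (c y, Literature.Analysis.Calculus.cjetOf bE 2 v y, fderiv ℝ c y (bE k)))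
          (fun z => fderiv ℝ v z (bE k)) x₀ ρ₁ hρ₁0 (by exact_mod_cast h4.1) h4.2 h2.1 h2.2 h3
          ⟨l, δ, hl, hδ, h5⟩ ρ hρ hρρ₁
        exact ⟨by exact_mod_cast h6.1, h6.2⟩
      -- Step 6: reassemble `D^{m+4}v` on `B(x₀, ρ)`
      have h1ρ : ContDiffOn ℝ (m + 3 : ℕ) v (ball x₀ ρ) ∧ ∃ B : NNReal,
          (∀ y ∈ ball x₀ ρ, ∀ j ≤ m + 3, ‖iteratedFDeriv ℝ j v y‖ ≤ B) ∧
          HolderOnWith B α (iteratedFDeriv ℝ (m + 3) v) (ball x₀ ρ) := by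
        obtain ⟨B, hB, hHo⟩ := h1.2
        exact ⟨h1c.mono hsubρ, B, fun y hy j hj => hB y (hsubρ hy) j hj, hHo.mono hsubρ⟩
      have h7 := Literature.Analysis.FunctionSpaces.holderData_succ_of_basis bE isOpen_ball
        (n := m + 3) (by omega) h1ρ hk
      have hcast : ((m + 1 : ℕ) : WithTop ℕ∞) + 3 = ((m + 3 + 1 : ℕ) : WithTop ℕ∞) := by
        push_cast
        ring
      rw [hcast]
      exact h7

end Summit.SmoothPoincare4.SmoothPoincare4.Theorems.MargerinRails
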